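import Summits.QuantumFields.BalabanUV.Beta.PolyRegularAlgebra

/-!
# Beta / JetCoefficientCauchy — LEMMA JC of CAP-KERNEL §4.14 in kernel form: the `[p₁p₂]`-coefficient of a function holomorphic
# on a closed bidisc of radius `r` is bounded by `(sup on the torus)/r²`, and the JET FUNCTIONAL `q ↦ [p₁p₂]f(q; ·)` inherits
# the (S4) binder from ANY certified bound (β sub-cell, CAP lane «KERNEL ALGEBRA + EXPORT», lineage `b2b-balaban-beta-cap3`,
# gen 8; companion of `Beta/PolyRegularAlgebra`)

The engines of the one-loop lane compute, per Bloch momentum `q`, the JET `[p₁p₂](t₁ − t₂)(q; p)/2` in the ring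
`ℂ[p₁,p₂]/(p₁², p₂²)` (cap1 ONE-LOOP-PIECES §10.0); for `(p₁, p₂) ↦ f(p₁, p₂)` holomorphic near the closed bidisc
`|p₁|, |p₂| ≤ r` that coefficient is the mixed derivative `∂₁∂₂ f(0, 0) = deriv (p₁ ↦ deriv (f p₁) 0) 0`, and Cauchy's
estimate applied twice gives `‖∂₁∂₂ f(0,0)‖ ≤ C/r²` from `‖f‖ ≤ C` on `|p₁| ≤ r, |p₂| = r` (`norm_mixedDeriv_le`, this
file's §1 — the analytic step of LEMMA JC (b)).  §2 restates the conclusion in the binder currency of the (S4) rows: if the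
jet functional `G q := deriv (p₁ ↦ deriv (f q p₁) 0) 0` is poly-holomorphic in `q` (`PolyHol`, from `PolyRegularAlgebra` —
the structural half, which for the cell follows from HOW `f` is built) then any certified `C` with `‖f q p₁ p₂‖ ≤ C` on
`Strip × closedBall × sphere` yields `StripRegularC G κ (C/r²)` (`stripRegularC_jet_of_bound`).  The choice `a + r ≤ a₀`
(zero-free half-width `a₀`, CAP-KERNEL §7) that makes `f q` holomorphic on the bidisc is the caller's: it enters only through
the hypotheses.

HONEST FRAMING.  Kernel form of a two-line Cauchy argument; no number of the β-function, no binder INSTANCE for the cell's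
integrand, no certificate (`C` is a hypothesis).  Discharging `BetaPertH` would make Bałaban's ultraviolet stability
unconditional — NOT the continuum limit and NOT the Clay problem.  [folklore] throughout; 0 `sorry`, 0 cite tags.
-/

namespace Summit.QuantumFields.BalabanUV.Beta.JetCoefficientCauchy

open Complex Set Metric
open Literature.MathematicalPhysics.QuantumFieldTheory.Balaban1983to89
open B4Strip (ofRealVec Strip)
open B4ContourShift
open Beta.AliasingTailL1
open Summit.QuantumFields.BalabanUV.Beta.PolyRegularAlgebra
open scoped Real

noncomputable section

variable {d : ℕ}

/-! ## §1 Cauchy's estimate applied twice: the mixed coefficient -/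

/-- THE MIXED-COEFFICIENT CAUCHY ESTIMATE: if for every `|p₁| ≤ r` the slice `p₂ ↦ f p₁ p₂` is holomorphic on the open disc
of radius `r > 0` and continuous on its closure with `‖f p₁ p₂‖ ≤ C` on the circle `|p₂| = r`, and the first coefficient
`p₁ ↦ deriv (f p₁) 0` is holomorphic on the open disc and continuous on the closed one, then
`‖deriv (p₁ ↦ deriv (f p₁) 0) 0‖ ≤ C / r²` — the bound `M_G = M′/(2r²)` of LEMMA JC up to the engines' factor `1/2`. [folklore] -/
theorem norm_mixedDeriv_le {f : ℂ → ℂ → ℂ} {r C : ℝ} (hr : 0 < r)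
    (h₂ : ∀ p₁ ∈ closedBall (0 : ℂ) r, DiffContOnCl ℂ (f p₁) (ball 0 r))
    (hC : ∀ p₁ ∈ closedBall (0 : ℂ) r, ∀ p₂ ∈ sphere (0 : ℂ) r, ‖f p₁ p₂‖ ≤ C)
    (h₁ : DiffContOnCl ℂ (fun p₁ => deriv (f p₁) 0) (ball 0 r)) :
    ‖deriv (fun p₁ => deriv (f p₁) 0) 0‖ ≤ C / r ^ 2 := by
  have inner : ∀ p₁ ∈ sphere (0 : ℂ) r, ‖deriv (f p₁) 0‖ ≤ C / r := fun p₁ hp₁ =>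
    norm_deriv_le_of_forall_mem_sphere_norm_le hr (h₂ p₁ (sphere_subset_closedBall hp₁))
      (hC p₁ (sphere_subset_closedBall hp₁))
  have h := norm_deriv_le_of_forall_mem_sphere_norm_le hr h₁ inner
  calc ‖deriv (fun p₁ => deriv (f p₁) 0) 0‖ ≤ C / r / r := h
    _ = C / r ^ 2 := by rw [div_div, pow_two]

/-- the same with the engines' normalisation `G = [p₁p₂](…)/2`: `‖(1/2)·∂₁∂₂f(0,0)‖ ≤ C/(2r²)`. [folklore] -/
theorem norm_half_mixedDeriv_le {f : ℂ → ℂ → ℂ} {r C : ℝ} (hr : 0 < r)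
    (h₂ : ∀ p₁ ∈ closedBall (0 : ℂ) r, DiffContOnCl ℂ (f p₁) (ball 0 r))
    (hC : ∀ p₁ ∈ closedBall (0 : ℂ) r, ∀ p₂ ∈ sphere (0 : ℂ) r, ‖f p₁ p₂‖ ≤ C)
    (h₁ : DiffContOnCl ℂ (fun p₁ => deriv (f p₁) 0) (ball 0 r)) :
    ‖(1 / 2 : ℂ) * deriv (fun p₁ => deriv (f p₁) 0) 0‖ ≤ C / (2 * r ^ 2) := by
  have h := norm_mixedDeriv_le hr h₂ hC h₁
  have hr2 : 0 < r ^ 2 := by positivity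
  rw [norm_mul]
  have e : ‖(1 / 2 : ℂ)‖ = 1 / 2 := by simp
  rw [e]
  calc 1 / 2 * ‖deriv (fun p₁ => deriv (f p₁) 0) 0‖ ≤ 1 / 2 * (C / r ^ 2) :=
        mul_le_mul_of_nonneg_left h (by norm_num)
    _ = C / (2 * r ^ 2) := by field_simp

/-! ## §2 The jet functional in the binder currency -/

/-- THE JET FUNCTIONAL of a `q`-family of functions of `(p₁, p₂)`: `G q := (1/2)·∂₁∂₂ f(q; 0, 0)`. [folklore] -/
def jetFunctional (f : (Fin (d + 1) → ℂ) → ℂ → ℂ → ℂ) (q : Fin (d + 1) → ℂ) : ℂ :=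
  (1 / 2 : ℂ) * deriv (fun p₁ => deriv (f q p₁) 0) 0

/-- LEMMA JC IN BINDER FORM: if the jet functional is poly-holomorphic in `q` on the strip of half-width `κ` (structure) and
for every `q` of the strip the `(p₁, p₂)`-slices satisfy the hypotheses of the mixed Cauchy estimate with a UNIFORM certified
bound `C` on `Strip × closedBall r × sphere r`, then `StripRegularC (jetFunctional f) κ (C/(2r²))`. [folklore] -/
theorem stripRegularC_jet_of_bound {f : (Fin (d + 1) → ℂ) → ℂ → ℂ → ℂ} {κ r C : ℝ} (hr : 0 < r)
    (hG : PolyHol (jetFunctional f) (fun _ => κ))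
    (h₂ : ∀ q ∈ Strip (d + 1) κ, ∀ p₁ ∈ closedBall (0 : ℂ) r, DiffContOnCl ℂ (f q p₁) (ball 0 r))
    (hC : ∀ q ∈ Strip (d + 1) κ, ∀ p₁ ∈ closedBall (0 : ℂ) r, ∀ p₂ ∈ sphere (0 : ℂ) r, ‖f q p₁ p₂‖ ≤ C)
    (h₁ : ∀ q ∈ Strip (d + 1) κ, DiffContOnCl ℂ (fun p₁ => deriv (f q p₁) 0) (ball 0 r)) :
    StripRegularC (jetFunctional f) κ (C / (2 * r ^ 2)) :=
  hG.stripRegularC fun q hq => norm_half_mixedDeriv_le hr (h₂ q hq) (hC q hq) (h₁ q hq)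

end

end Summit.QuantumFields.BalabanUV.Beta.JetCoefficientCauchy
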